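import Mathlib.MeasureTheory.Integral.MeanInequalities
import Summits.AtomisticToContinuum.HydrodynamicLimit.Theorems.TwoClocksEquilibriumShearWindowLDWindows

/-!
# Stub `stub_holderSplit` of the line `Sketch` (doubling RG, bounded normal form) for the crux
`TwoClocks.EquilibriumFastWindowLD` (stmt-AtomisticToContinuum-14440)

Hölder split of the window exponential moment of a SUM of two one-body observables. Write, for a
hard-sphere flow `Φ` of `N + 1` spheres on `𝕋³`, a window `w > 0` and a continuous `F : 𝕋³ × ℝ³ → ℝ`,
`W^F_w(z) := Σᵢ w⁻¹ ∫₀ʷ F((Φ_r z)ᵢ) dr` and `M^F(β) := ∫⁻ exp(β W^F_w) dG_N` under the homogeneous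
(constant-profile) Gibbs law `G_N = localGibbsLaw σ a₀ u₀ θ₀ N Φ`. Then for continuous `G, T`, every
tilt `β` and every weight `0 < ϑ < 1`:

`M^{G+T}(β) ≤ M^G(β/(1−ϑ))^{1−ϑ} · M^T(β/ϑ)^ϑ`.

Proof: `G_N` is carried by the good set of the flow (`localGibbsLaw_const_compl_good`); on the good
set the window functional is additive in the observable (both orbit functions are interval
integrable: continuous observable, measurable orbit, speeds bounded by energy conservation), so
`β W^{G+T} = (1−ϑ) X + ϑ Y` with `X = β/(1−ϑ) W^G`, `Y = β/ϑ W^T`, and Hölder with the conjugate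
exponents `1/(1−ϑ)`, `1/ϑ` (`ENNReal.lintegral_mul_le_Lp_mul_Lq`) concludes. No invariance and no
dynamics beyond energy conservation on good orbits is used.
-/

noncomputable section

open MeasureTheory ProbabilityTheory Real Set Filter
open scoped ENNReal BigOperators

namespace Summit.AtomisticToContinuum.HydrodynamicLimit.Theorems.FastWindowRG

open Literature.Analysis.FluidPDE Literature.MathematicalPhysics.KineticTheory

/-- A continuous one-body observable along a good orbit is interval integrable: the orbit is
measurable in time (`IsHardSphereTrajectory.measurable_torus`) and particle `i` stays in the compact
set `univ ×ˢ closedBall 0 √(2E(z))` by energy conservation. (Copy of the block in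
`window_integral_add_window`.) -/
private theorem intervalIntegrable_orbit {ε : ℝ} {n : ℕ}
    (Φ : HardSphereFlow (Torus.geometry (Fin 3)) ε n) {z : Config n (Fin 3) T3} (hz : z ∈ Φ.good)
    {F : T3 × V3 → ℝ} (hF : Continuous F) (i : Fin n) (a b : ℝ) :
    IntervalIntegrable (fun r => F (Φ.flow r z i)) volume a b := by
  have hγ : Measurable fun t => Φ.flow t z := (Φ.isTrajectory z hz).measurable_torus
  have hm : Measurable fun r => F (Φ.flow r z i) :=
    hF.measurable.comp ((measurable_pi_apply i).comp hγ)
  set K : Set (T3 × V3) :=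
    Set.univ ×ˢ Metric.closedBall (0 : V3) (Real.sqrt (2 * configEnergy z))
  have hK : IsCompact K := isCompact_univ.prod (isCompact_closedBall _ _)
  have hmem : ∀ r, Φ.flow r z i ∈ K := by
    intro r
    refine ⟨Set.mem_univ _, ?_⟩
    rw [Metric.mem_closedBall, dist_zero_right]
    refine Real.le_sqrt_of_sq_le ?_
    exact (norm_vel_sq_le_two_mul_configEnergy _ i).trans_eq (by rw [Φ.configEnergy_flow hz r])
  obtain ⟨B, hB⟩ := hK.exists_bound_of_continuousOn hF.continuousOn
  exact (intervalIntegrable_const (c := B)).mono_fun' hm.aestronglyMeasurable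
    (ae_of_all _ fun r => hB _ (hmem r))

/-- Additivity of the window functional in the observable along good orbits: for continuous `G, T`
and `z` good, `W^{G+T}_w(z) = W^G_w(z) + W^T_w(z)`. -/
private theorem windowSum_add_observable {ε : ℝ} {n : ℕ}
    (Φ : HardSphereFlow (Torus.geometry (Fin 3)) ε n) {z : Config n (Fin 3) T3} (hz : z ∈ Φ.good)
    {G T : T3 × V3 → ℝ} (hG : Continuous G) (hT : Continuous T) (w : ℝ) :
    ∑ i, w⁻¹ * ∫ r in (0 : ℝ)..w, (G (Φ.flow r z i) + T (Φ.flow r z i)) =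
      (∑ i, w⁻¹ * ∫ r in (0 : ℝ)..w, G (Φ.flow r z i)) +
        ∑ i, w⁻¹ * ∫ r in (0 : ℝ)..w, T (Φ.flow r z i) := by
  rw [← Finset.sum_add_distrib]
  refine Finset.sum_congr rfl fun i _ => ?_
  rw [intervalIntegral.integral_add (intervalIntegrable_orbit Φ hz hG i 0 w)
    (intervalIntegrable_orbit Φ hz hT i 0 w)]
  ring

/-- **NF-b `stub_holderSplit`** (statics). Under the homogeneous Gibbs law, for continuous one-body
`G, T`, a tilt `β`, a weight `0 < ϑ < 1` and a window `w > 0`: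
`M^{G+T}(β) ≤ M^G(β/(1−ϑ))^{1−ϑ} · M^T(β/ϑ)^ϑ` (additivity of the window functional on the good set,
Hölder with exponents `1/(1−ϑ)`, `1/ϑ`; no invariance needed). -/
theorem stub_holderSplit (σ a₀ θ₀ : ℝ) (u₀ : V3) (N : ℕ)
    (Φ : HardSphereFlow (Torus.geometry (Fin 3)) (hsDiameter σ N) (N + 1))
    {G T : T3 × V3 → ℝ} (hG : Continuous G) (hT : Continuous T) (β : ℝ) {ϑ : ℝ} (hϑ0 : 0 < ϑ)
    (hϑ1 : ϑ < 1) {w : ℝ} (hw : 0 < w) :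
    ∫⁻ z, ENNReal.ofReal (Real.exp (β * ∑ i : Fin (N + 1),
        w⁻¹ * ∫ r in (0 : ℝ)..w, (G (Φ.flow r z i) + T (Φ.flow r z i))))
      ∂(localGibbsLaw σ (fun _ => a₀) (fun _ => u₀) (fun _ => θ₀) N Φ) ≤
      (∫⁻ z, ENNReal.ofReal (Real.exp (β / (1 - ϑ) * ∑ i : Fin (N + 1),
          w⁻¹ * ∫ r in (0 : ℝ)..w, G (Φ.flow r z i)))
        ∂(localGibbsLaw σ (fun _ => a₀) (fun _ => u₀) (fun _ => θ₀) N Φ)) ^ (1 - ϑ) *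
      (∫⁻ z, ENNReal.ofReal (Real.exp (β / ϑ * ∑ i : Fin (N + 1),
          w⁻¹ * ∫ r in (0 : ℝ)..w, T (Φ.flow r z i)))
        ∂(localGibbsLaw σ (fun _ => a₀) (fun _ => u₀) (fun _ => θ₀) N Φ)) ^ ϑ := by
  -- (the window functional is additive along good orbits for EVERY `w`; positivity of the window is
  -- part of the registered signature but not needed)
  have _ := hw
  -- the law is carried by the good set of the flow
  have hμ : localGibbsLaw σ (fun _ => a₀) (fun _ => u₀) (fun _ => θ₀) N Φ Φ.goodᶜ = 0 :=
    localGibbsLaw_const_compl_good σ a₀ θ₀ u₀ N Φ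
  have hϑ1' : 0 < 1 - ϑ := sub_pos.2 hϑ1
  -- the two tilted window functionals
  set X : Config (N + 1) (Fin 3) T3 → ℝ :=
    fun z => β / (1 - ϑ) * ∑ i, w⁻¹ * ∫ r in (0 : ℝ)..w, G (Φ.flow r z i) with hX
  set Y : Config (N + 1) (Fin 3) T3 → ℝ :=
    fun z => β / ϑ * ∑ i, w⁻¹ * ∫ r in (0 : ℝ)..w, T (Φ.flow r z i) with hY
  have hXm : AEMeasurable X (localGibbsLaw σ (fun _ => a₀) (fun _ => u₀) (fun _ => θ₀) N Φ) :=
    aemeasurable_windowSum Φ hμ hG (β / (1 - ϑ)) w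
  have hYm : AEMeasurable Y (localGibbsLaw σ (fun _ => a₀) (fun _ => u₀) (fun _ => θ₀) N Φ) :=
    aemeasurable_windowSum Φ hμ hT (β / ϑ) w
  -- pathwise factorisation on the good set
  have hgood : ∀ᵐ z ∂(localGibbsLaw σ (fun _ => a₀) (fun _ => u₀) (fun _ => θ₀) N Φ),
      z ∈ Φ.good :=
    (measure_eq_zero_iff_ae_notMem.1 hμ).mono fun z hz => by simpa using hz
  have hae : ∀ᵐ z ∂(localGibbsLaw σ (fun _ => a₀) (fun _ => u₀) (fun _ => θ₀) N Φ),
      ENNReal.ofReal (Real.exp (β * ∑ i : Fin (N + 1),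
        w⁻¹ * ∫ r in (0 : ℝ)..w, (G (Φ.flow r z i) + T (Φ.flow r z i)))) =
      ENNReal.ofReal (Real.exp ((1 - ϑ) * X z)) * ENNReal.ofReal (Real.exp (ϑ * Y z)) := by
    filter_upwards [hgood] with z hz
    rw [windowSum_add_observable Φ hz hG hT w, ← ENNReal.ofReal_mul (Real.exp_nonneg _),
      ← Real.exp_add]
    congr 2
    simp only [hX, hY]
    field_simp
  rw [lintegral_congr_ae hae]
  -- Hölder with exponents `1/(1-ϑ)`, `1/ϑ`
  have hpq : ((1 - ϑ)⁻¹).HolderConjugate ϑ⁻¹ :=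
    { inv_add_inv_eq_inv := by rw [inv_inv, inv_inv, inv_one]; ring
      left_pos := inv_pos.2 hϑ1'
      right_pos := inv_pos.2 hϑ0 }
  have hf : AEMeasurable (fun z => ENNReal.ofReal (Real.exp ((1 - ϑ) * X z)))
      (localGibbsLaw σ (fun _ => a₀) (fun _ => u₀) (fun _ => θ₀) N Φ) :=
    (Real.measurable_exp.comp_aemeasurable (hXm.const_mul (1 - ϑ))).ennreal_ofReal
  have hg : AEMeasurable (fun z => ENNReal.ofReal (Real.exp (ϑ * Y z)))
      (localGibbsLaw σ (fun _ => a₀) (fun _ => u₀) (fun _ => θ₀) N Φ) :=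
    (Real.measurable_exp.comp_aemeasurable (hYm.const_mul ϑ)).ennreal_ofReal
  have hH := ENNReal.lintegral_mul_le_Lp_mul_Lq
    (localGibbsLaw σ (fun _ => a₀) (fun _ => u₀) (fun _ => θ₀) N Φ) hpq hf hg
  simp only [Pi.mul_apply, one_div, inv_inv, ofReal_exp_mul_rpow (mul_inv_cancel₀ hϑ1'.ne'),
    ofReal_exp_mul_rpow (mul_inv_cancel₀ hϑ0.ne')] at hH
  exact hH

end Summit.AtomisticToContinuum.HydrodynamicLimit.Theorems.FastWindowRG

end
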